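import Summits.BirchSwinnertonDyer.BirchSwinnertonDyer.Theses.UniversalToricDescent

/-!
# RK-6 v3 — μ-SOURCE REPAIR of the rational road (pen bsd-wall-pss3x g8; answer to LEAD utd-p1 g19 07:55:43Z)

kernel_rat 24208 AS TYPED has no μ-source (utd-p1: kernel⁵ takes μ(X_E)=0 and twin torsion from the INTEGRAL wall;
rational wall + degree-only twin + analytic μ leaves μ(X_E) free). Repair R-a in the no-forward-reference shape:
* NEW item `TwinAlgMuZeroAtThree` (twin-side ALGEBRAIC μ = 0 + torsion; binders = `TwinSplitIMCAtThree` 20214's prefix VERBATIM);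
* NEW package `ToricDefectEitherRoadMuAtThree` := integral road ∨ (rational road ∧ TwinAlgMu) (supersedes 24209);
* NEW kernel `ToricKernelAtThreeApZeroOddRationalTwinMuOfPrint` := kernel_rat's text with `TwinAlgMuZeroAtThree` inserted after
  `TwinMuZeroAtThree` (supersedes 24208, which is unclosable as typed);
* `closes` re-keyed (hP, hKr); 24208/24209 to be dropped. Typed against the LIVE route (rev 81); all by NAME.
-/

namespace Summit.BirchSwinnertonDyer.BirchSwinnertonDyer.Theses.UniversalToricDescent

/-- NEW item (support → crux after vet): twin-side algebraic μ = 0 and Λ-torsion of X_(∅,0)(E′/K_∞^ac) at p = 3. -/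
def TwinAlgMuZeroAtThree : Prop :=
  ∀ (W' : WeierstrassCurve ℚ) [W'.IsElliptic] [W'.IsGloballyMinimal] (N' : ℕ) [NeZero N'] (K : Type) [Field K] [NumberField K] (Dt' : Literature.NumberTheory.EllipticCurves.ModularForms.ModularParametrizationData W' N'), ¬ Literature.NumberTheory.EllipticCurves.Rank1Residual.Addv W' 3 → W'.HasSurjectiveModNGaloisRep 3 → W'.conductorNorm ℤ = N' → Literature.NumberTheory.EllipticCurves.IsImaginaryQuadratic K → Literature.NumberTheory.EllipticCurves.SatisfiesHeegnerHypothesis N' K → ∀ (κ : Literature.NumberTheory.EllipticCurves.ZpExtension K 3), κ.IsAnticyclotomic → ∀ (γ : Field.absoluteGaloisGroup K) [Fact (κ.IsTopGenerator γ)] (𝔭 : IsDedekindDomain.HeightOneSpectrum (NumberField.RingOfIntegers K)), ((3 : ℕ) : NumberField.RingOfIntegers K) ∈ 𝔭.asIdeal → 𝔭.asIdeal.ramificationIdx (NumberField.RingOfIntegers ℚ) = 1 → 𝔭.asIdeal.inertiaDeg (NumberField.RingOfIntegers ℚ) = 1 → ∀ (𝔭' : IsDedekindDomain.HeightOneSpectrum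 (NumberField.RingOfIntegers K)), ((3 : ℕ) : NumberField.RingOfIntegers K) ∈ 𝔭'.asIdeal → 𝔭' ≠ 𝔭 → Module.IsTorsion (Literature.NumberTheory.EllipticCurves.IwasawaAlgebra 3) (Summit.BirchSwinnertonDyer.Rank1Residual.X11b.AcSelmer.XAc (W'.baseChange K) 3 κ 𝔭' ∅ γ) ∧ ∃ g' : Literature.NumberTheory.EllipticCurves.UnrSeries 3, (Summit.BirchSwinnertonDyer.Rank1Residual.X11b.AcSelmer.XAc.charIdeal (W'.baseChange K) 3 κ 𝔭' ∅ γ).map (PowerSeries.map (Summit.BirchSwinnertonDyer.Rank1Residual.X11b.Halves.toUnr 3)) = Ideal.span {g'} ∧ ∃ i : ℕ, ‖((PowerSeries.coeff i g' : Literature.NumberTheory.EllipticCurves.unrIntegers 3) : ℂ_[3])‖ = 1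

/-- NEW package (closes binder hP): either road, the rational one now carrying its μ-source. -/
def ToricDefectEitherRoadMuAtThree : Prop :=
  (DefectTransportModThreePT ∧ AdditiveSplitIMCInclusionAtThree ∧ TwinMuZeroAtThree) ∨ (SigmaCongruenceAtThree ∧ RationalSplitIMCInclusionAtThree ∧ TwinMuZeroAtThree ∧ TwinAlgMuZeroAtThree)

/-- NEW kernel (closes binder hKr): kernel_rat with the twin algebraic μ antecedent. -/
def ToricKernelAtThreeApZeroOddRationalTwinMuOfPrint : Prop :=
  ToricPublishedInputs → SigmaCongruenceAtThree → RationalSplitIMCInclusionAtThree → TwinMuZeroAtThree → TwinAlgMuZeroAtThree → TwinDegreeFrameAtThreeMultTresT ∧ TwinDegreeFrameAtThreeGoodSSApZeroT → GoodSSApZeroTwinSupplyAtThree → PeuRamifieMultTwinResupplyAtThree → WildSplitPrintedInputsAtThree → WildSplitFrameAtThreeOddOfPrint → ToricPrintedLeavesAtThree → WildRankZeroTwistAtThree → ∀ (W : WeierstrassCurve ℚ) [W.IsElliptic] [W.IsGloballyMinimal], Summit.BirchSwinnertonDyer.Rank1Residual.Additive.ClassO6 W 3 → W.analyticRank = 1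 → W.HasSurjectiveModNGaloisRep 3 → (∃ (W' : WeierstrassCurve ℚ) (_ : W'.IsElliptic) (_ : W'.IsGloballyMinimal), Summit.BirchSwinnertonDyer.Rank1Residual.O6.ModPCongruent W' W 3 ∧ ¬ Literature.NumberTheory.EllipticCurves.Rank1Residual.Addv W' 3 ∧ W'.HasSurjectiveModNGaloisRep 3) → Literature.NumberTheory.EllipticCurves.BSDp W 3

namespace RK6v3

theorem closes_v4 (hF : ToricPublishedInputs) (hP : ToricDefectEitherRoadMuAtThree) (hB : TwinDegreeFrameAtThreeMultTresT) (hC : TwinDegreeFrameAtThreeGoodSSApZeroT) (hsupply : GoodSSApZeroTwinSupplyAtThree) (hR : PeuRamifieMultTwinResupplyAtThree) (hW : WildSplitPrintedInputsAtThree) (hS : WildSplitFrameAtThreeOddOfPrint) (hL : ToricPrintedLeavesAtThree) (hZ : WildRankZeroTwistAtThree) (hK : ToricKernelAtThreeApZeroOddDegreeOfPrint) (hKr : ToricKernelAtThreeApZeroOddRationalTwinMuOfPrint) : Summit.BirchSwinnertonDyer.WAllExclAddWildRankOneSurjTwin := hP.elim (fun h ↦ Summit.BirchSwinnertonDyer.wAllExclAddWildRankOneSurjTwin_of_forall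 (hK hF h.1 h.2.1 h.2.2 ⟨hB, hC⟩ hsupply hR hW hS hL hZ)) (fun h ↦ Summit.BirchSwinnertonDyer.wAllExclAddWildRankOneSurjTwin_of_forall (hKr hF h.1 h.2.1 h.2.2.1 h.2.2.2 ⟨hB, hC⟩ hsupply hR hW hS hL hZ))

/-- the v2 package feeds the v3 package given TwinAlgMu on the rational side. -/
theorem pkg3_of_pkg2 (h : ToricDefectEitherRoadAtThree) (ht : TwinAlgMuZeroAtThree) : ToricDefectEitherRoadMuAtThree :=
  h.elim (fun hi ↦ Or.inl hi) (fun hr ↦ Or.inr ⟨hr.1, hr.2.1, hr.2.2, ht⟩)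

/-- the old integral package still feeds the new binder. -/
theorem pkg3_of_old (h : ToricDefectWallMuAtThree) : ToricDefectEitherRoadMuAtThree := Or.inl h

end RK6v3

end Summit.BirchSwinnertonDyer.BirchSwinnertonDyer.Theses.UniversalToricDescent
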